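import Summits.ValiantsHypothesis.ValiantsHypothesis.Theorems.LacunarySymmetroidMatrixDescartesDoorA26WallBubblingWeylQuadHeads
import Summits.ValiantsHypothesis.ValiantsHypothesis.Theorems.LacunarySymmetroidMatrixDescartesDoorA26WallBubblingWeylTripleDichotomy
import Summits.ValiantsHypothesis.ValiantsHypothesis.Theorems.LacunarySymmetroidMatrixDescartesDoorA26WallBubblingWeylTripleRigidity
import Summits.ValiantsHypothesis.ValiantsHypothesis.Theorems.LacunarySymmetroidMatrixDescartesDoorA26WallBubblingLevelSelectionMulti

/-!
# Wall bubbling for `DoorA26` — WEYL QUADRUPLES: THE RIGIDITY DICHOTOMY (tenth slot alive ⇒ every pure class dies)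

HONEST FRAMING.  Chain lemma toward `TripleStratum26` of `Cruxes/DoorA26/Lines/wall_bubbling_ConfluentDoor.lean` (rev 13; crux `DoorA26`,
stmt-ValiantsHypothesis-19979 — OPEN, typed, never asserted), patterns [4,1,1] / [4,2] (a QUADRUPLE `δ_i = δ_j = δ_k = δ_l`, covered by the
«∃ triple» binder).  W1 seat val-sym-door-p2 g15 (#93); the four-letter analogue of #88 `weylTriple_dichotomy`, in the size-free frame language of
#92 `…FrameTail`.  Four symmetric letters `V_l : Fin 4 → M₂(ℝ)` with deviations `x_l → 0`: the class `2α` has 16 ordered members, TEN function-level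
slots (`M_0 … M_9`) but only SEVEN Gram slots (`i + j ≤ 6`, `i, j ≤ 3`), and the frame `T₀..T₃` is linearly DEPENDENT in the 3-space `Sym₂(ℝ)`.

(heads and the dependence lemma in #93a `…WeylQuadHeads`.)
* **`weylQuad_dichotomy`** — along a sequence of levels with a scale `N_l > 0` dominating `M_0..M_8` and the mixed pairings `polar(W, T_j)` (`j ≤ 3`),
  it is IMPOSSIBLE that both `M_9/N_l → c₉ ≠ 0` (tenth slot alive) and `polar(W^a_l, W^b_l)/N_l → d ≠ 0`.  Mechanism: #92 makes `M_9 = O(w)·‖G‖`, so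
  `N/‖G‖ → 0`; `M_0..M_6 = O(N)` force `G/‖G‖ → β∞` with `β∞₀₀ = β∞₀₁ = β∞₂₃ = β∞₃₃ = 0`, `β∞₁₁ = −β∞₀₂`, `3β∞₁₂ = −β∞₀₃`, `3β∞₂₂ = −4β∞₁₃`;
  dependence gives a kernel vector of `β∞`; hence (cases) a principal `3 × 3` minor with `det = X³` or `4Z³/3 ≠ 0`, and #85's Schur bound on that
  sub-frame kills the pure pairing.

Nothing here bears on `DoorA26`, `MatrixDescartes` (stmt-ValiantsHypothesis-18050) or `VP ≠ VNP`; `TripleStratum26`, (W), (M) OPEN.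
`--supports stmt-ValiantsHypothesis-19979 --as helper`.  [this work].
-/

-- `Summit.ValiantsHypothesis.ValiantsHypothesis.…` repeats a component by the D-0017 layout
-- (single-conjunct summit), which the `dupNamespace` linter flags; the name is mandated.
set_option linter.dupNamespace false

namespace Summit.ValiantsHypothesis.ValiantsHypothesis.Theorems.LacunarySymmetroidMatrixDescartes.WallBubbling

open Finset Filter Topology
open Bubbling (polar polar_apply)
open scoped BigOperators

/-! ## 3. The dichotomy -/

/-- **THE RIGIDITY DICHOTOMY AT A WEYL QUADRUPLE.**  See the module docstring. [this work] -/
theorem weylQuad_dichotomy (V : ℕ → Fin 4 → Matrix (Fin 2) (Fin 2) ℝ) (hV : ∀ l p, (V l p).IsSymm)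
    (x : ℕ → Fin 4 → ℝ) (hx : ∀ p, Tendsto (fun l => x l p) atTop (𝓝 0))
    (Wa Wb : ℕ → Matrix (Fin 2) (Fin 2) ℝ) (hWa : ∀ l, (Wa l).IsSymm) (hWb : ∀ l, (Wb l).IsSymm)
    (N : ℕ → ℝ) (hN : ∀ l, 0 < N l)
    (hhead : ∀ l, ∀ m ≤ 8, |∑ p, ∑ q, polar (V l p) (V l q) * (x l p + x l q) ^ m| ≤ N l)
    (c9 : ℝ) (hc9 : c9 ≠ 0)
    (h9 : Tendsto (fun l => (∑ p, ∑ q, polar (V l p) (V l q) * (x l p + x l q) ^ 9) / N l) atTop (𝓝 c9))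
    (hmixa : ∀ l (m : ℕ), m ≤ 3 → |polar (Wa l) (∑ q, x l q ^ m • V l q)| ≤ N l)
    (hmixb : ∀ l (m : ℕ), m ≤ 3 → |polar (∑ q, x l q ^ m • V l q) (Wb l)| ≤ N l)
    (d : ℝ) (hd : d ≠ 0) (hpure : Tendsto (fun l => polar (Wa l) (Wb l) / N l) atTop (𝓝 d)) : False := by
  classical
  obtain ⟨Ch, hCh0, hCh⟩ := blockMoment_head 4
  -- frame, Gram, moments, deviation size
  set T : ℕ → ℕ → Matrix (Fin 2) (Fin 2) ℝ := fun l i => ∑ q, x l q ^ i • V l q with hT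
  set G : ℕ → Fin 4 × Fin 4 → ℝ := fun l ij => polar (T l ij.1) (T l ij.2) with hG
  set M : ℕ → ℕ → ℝ := fun l m => ∑ p, ∑ q, polar (V l p) (V l q) * (x l p + x l q) ^ m with hM
  set w : ℕ → ℝ := fun l => ∑ p, |x l p| with hw
  have hw0 : ∀ l, 0 ≤ w l := fun l => Finset.sum_nonneg fun p _ => abs_nonneg _
  have hxw : ∀ l p, |x l p| ≤ w l := fun l p => Finset.single_le_sum (f := fun p => |x l p|) (fun _ _ => abs_nonneg _) (Finset.mem_univ p)
  have hwlim : Tendsto w atTop (𝓝 0) := by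
    have := tendsto_finsetSum (Finset.univ : Finset (Fin 4)) fun p _ => (continuous_abs.tendsto _).comp (hx p)
    simpa [hw] using this
  have hTsymm : ∀ l i, (T l i).IsSymm := by
    intro l i
    simp only [hT]
    unfold Matrix.IsSymm
    rw [Matrix.transpose_sum]
    exact Finset.sum_congr rfl fun q _ => by rw [Matrix.transpose_smul, (hV l q)]
  have hGsymm : ∀ l i j, G l (i, j) = G l (j, i) := fun l i j => Bubbling.polar_comm _ _
  -- Step 1: shift to levels with `w ≤ 1/2` and `M_9 ≠ 0`
  obtain ⟨l₀, hl₀⟩ : ∃ l₀, ∀ l, l₀ ≤ l → w l ≤ 1 / 2 ∧ M l 9 ≠ 0 := by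
    obtain ⟨l₁, hl₁⟩ := eventually_ne_zero_of_tendsto h9 hc9
    have hev : ∀ᶠ l in atTop, w l ≤ 1 / 2 := hwlim.eventually (Iic_mem_nhds (by norm_num : (0 : ℝ) < 1 / 2))
    obtain ⟨l₂, hl₂⟩ := eventually_atTop.mp hev
    refine ⟨max l₁ l₂, fun l hl => ⟨hl₂ l (le_of_max_le_right hl), fun h0 => hl₁ l (le_of_max_le_left hl) ?_⟩⟩
    change M l 9 / N l = 0; rw [h0, zero_div]
  -- the Gram scale
  set g : ℕ → ℝ := fun l => (univ : Finset (Fin 4 × Fin 4)).sup' Finset.univ_nonempty (fun ij => |G l ij|) with hg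
  have hdomG : ∀ l ij, |G l ij| ≤ g l := fun l ij => Finset.le_sup' (fun ij => |G l ij|) (Finset.mem_univ ij)
  have hattG : ∀ l, ∃ ij, |G l ij| = g l := by
    intro l
    obtain ⟨ij, _, h⟩ := Finset.exists_mem_eq_sup' (Finset.univ_nonempty (α := Fin 4 × Fin 4)) (fun ij => |G l ij|)
    exact ⟨ij, h.symm⟩
  have hg0 : ∀ l, 0 ≤ g l := fun l => (abs_nonneg _).trans (hdomG l (0, 0))
  have hdomGn : ∀ l (i j : ℕ), i < 4 → j < 4 → |polar (∑ q, x l q ^ i • V l q) (∑ q, x l q ^ j • V l q)| ≤ g l :=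
    fun l i j hi hj => hdomG l (⟨i, hi⟩, ⟨j, hj⟩)
  -- the head decomposition of #92 at every shifted level
  have hhd : ∀ l, l₀ ≤ l → ∀ m, |M l m - ∑ i ∈ (Finset.range (m + 1)).filter (fun i => i < 4 ∧ m - i < 4),
      (m.choose i : ℝ) * polar (T l i) (T l (m - i))| ≤ Ch * 2 ^ m * w l * g l :=
    fun l hl m => hCh (by simp) (V l) (x l) (w l) (hw0 l) (hl₀ l hl).1 (hxw l) (g l) (hg0 l) (hdomGn l) m
  have heads : ∀ l, (∑ i ∈ (Finset.range 1).filter (fun i => i < 4 ∧ 0 - i < 4), ((0 : ℕ).choose i : ℝ) * polar (T l i) (T l (0 - i))) = G l (0, 0) ∧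
      (∑ i ∈ (Finset.range 2).filter (fun i => i < 4 ∧ 1 - i < 4), ((1 : ℕ).choose i : ℝ) * polar (T l i) (T l (1 - i))) = 2 * G l (0, 1) ∧
      (∑ i ∈ (Finset.range 3).filter (fun i => i < 4 ∧ 2 - i < 4), ((2 : ℕ).choose i : ℝ) * polar (T l i) (T l (2 - i))) = 2 * G l (0, 2) + 2 * G l (1, 1) ∧
      (∑ i ∈ (Finset.range 4).filter (fun i => i < 4 ∧ 3 - i < 4), ((3 : ℕ).choose i : ℝ) * polar (T l i) (T l (3 - i))) = 2 * G l (0, 3) + 6 * G l (1, 2) ∧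
      (∑ i ∈ (Finset.range 5).filter (fun i => i < 4 ∧ 4 - i < 4), ((4 : ℕ).choose i : ℝ) * polar (T l i) (T l (4 - i))) = 8 * G l (1, 3) + 6 * G l (2, 2) ∧
      (∑ i ∈ (Finset.range 6).filter (fun i => i < 4 ∧ 5 - i < 4), ((5 : ℕ).choose i : ℝ) * polar (T l i) (T l (5 - i))) = 20 * G l (2, 3) ∧
      (∑ i ∈ (Finset.range 7).filter (fun i => i < 4 ∧ 6 - i < 4), ((6 : ℕ).choose i : ℝ) * polar (T l i) (T l (6 - i))) = 20 * G l (3, 3) ∧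
      (∑ i ∈ (Finset.range 10).filter (fun i => i < 4 ∧ 9 - i < 4), ((9 : ℕ).choose i : ℝ) * polar (T l i) (T l (9 - i))) = 0 :=
    fun l => quadHead_eval (fun i j => polar (T l i) (T l j)) (fun i j => Bubbling.polar_comm _ _)
  -- `g > 0` at the shifted levels
  have hgpos : ∀ l, l₀ ≤ l → 0 < g l := by
    intro l hl
    rcases (hg0 l).lt_or_eq with h | h
    · exact h
    · exfalso
      have h9' := hhd l hl 9
      rw [(heads l).2.2.2.2.2.2.2, sub_zero, ← h, mul_zero] at h9'
      exact (hl₀ l hl).2 (abs_eq_zero.mp (le_antisymm h9' (abs_nonneg _)))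
  -- Step 2: extraction for the normalised Gram (shifted by `l₀`)
  obtain ⟨ψ, hψ, β, hβ, hβle, ⟨ij₁, hij₁⟩⟩ := levelSelection_multi (fun l ij => G (l + l₀) ij) (fun l => g (l + l₀))
    (fun l => hgpos _ (Nat.le_add_left _ _)) (fun l ij => hdomG _ ij) (fun l => hattG _)
  -- kernel vectors (four letters in a 3-space) and their extraction
  have hker := fun l => symm_frame_dependent (fun i : Fin 4 => T l i) (fun i => hTsymm l i)
  choose kv hkvle hkvatt hkv using hker
  obtain ⟨ψ', hψ', kinf, hkinf, -, ⟨i₂, hi₂⟩⟩ := levelSelection_multi (fun l i => kv (ψ l + l₀) i) (fun _ => (1 : ℝ))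
    (fun _ => one_pos) (fun l i => hkvle _ i) (fun l => hkvatt _)
  -- along `σ l = ψ (ψ' l) + l₀`
  set σ : ℕ → ℕ := fun l => ψ (ψ' l) + l₀ with hσ
  have hσmono : StrictMono σ := fun a b hab => by simp only [hσ]; exact Nat.add_lt_add_right (hψ (hψ' hab)) _
  have hσge : ∀ l, l₀ ≤ σ l := fun l => Nat.le_add_left _ _
  have hσtop : Tendsto σ atTop atTop := hσmono.tendsto_atTop
  have hβ' : ∀ ij, Tendsto (fun l => G (σ l) ij / g (σ l)) atTop (𝓝 (β ij)) := fun ij => (hβ ij).comp hψ'.tendsto_atTop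
  have hkv' : ∀ i, Tendsto (fun l => kv (σ l) i) atTop (𝓝 (kinf i)) := fun i => by simpa using hkinf i
  have hw' : Tendsto (fun l => w (σ l)) atTop (𝓝 0) := hwlim.comp hσtop
  have hgσ : ∀ l, 0 < g (σ l) := fun l => hgpos _ (hσge l)
  have hNσ : ∀ l, 0 < N (σ l) := fun l => hN _
  -- Step 3: `M_9/g → 0`, hence `N/g → 0`
  have hM9g : Tendsto (fun l => M (σ l) 9 / g (σ l)) atTop (𝓝 0) := by
    refine tendsto_zero_of_abs_le_mul (Ch * 2 ^ 9) hw' (Filter.Eventually.of_forall fun l => ?_)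
    have h := hhd (σ l) (hσge l) 9
    rw [(heads (σ l)).2.2.2.2.2.2.2, sub_zero] at h
    rw [abs_div, abs_of_pos (hgσ l), div_le_iff₀ (hgσ l)]
    calc |M (σ l) 9| ≤ Ch * 2 ^ 9 * w (σ l) * g (σ l) := h
      _ = Ch * 2 ^ 9 * w (σ l) * g (σ l) := rfl
  have hNg : Tendsto (fun l => N (σ l) / g (σ l)) atTop (𝓝 0) := by
    have h9σ : Tendsto (fun l => M (σ l) 9 / N (σ l)) atTop (𝓝 c9) := h9.comp hσtop
    have h := hM9g.div h9σ hc9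
    rw [zero_div] at h
    refine h.congr fun l => ?_
    have h1 : M (σ l) 9 ≠ 0 := (hl₀ _ (hσge l)).2
    have h2 : N (σ l) ≠ 0 := ne_of_gt (hNσ l)
    have h3 : g (σ l) ≠ 0 := ne_of_gt (hgσ l)
    simp only [Pi.div_apply]
    field_simp
  -- Step 4: the constraints on `β` from `M_0..M_6 = O(N)`
  have hsmall : ∀ (u : ℕ → ℝ) (C : ℝ), (∀ l, |u l| ≤ C * N (σ l)) → Tendsto (fun l => u l / g (σ l)) atTop (𝓝 0) := by
    intro u C hu
    refine tendsto_zero_of_abs_le_mul C hNg (Filter.Eventually.of_forall fun l => ?_)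
    rw [abs_div, abs_of_pos (hgσ l), div_le_iff₀ (hgσ l)]
    have hg1 : g (σ l) ≠ 0 := ne_of_gt (hgσ l)
    have heq : C * (N (σ l) / g (σ l)) * g (σ l) = C * N (σ l) := by field_simp
    rw [heq]; exact hu l
  -- `head_m / g → 0` for `m ≤ 6`
  have hheadlim : ∀ m, m ≤ 6 → Tendsto (fun l => (∑ i ∈ (Finset.range (m + 1)).filter (fun i => i < 4 ∧ m - i < 4),
      (m.choose i : ℝ) * polar (T (σ l) i) (T (σ l) (m - i))) / g (σ l)) atTop (𝓝 0) := by
    intro m hm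
    have hMg : Tendsto (fun l => M (σ l) m / g (σ l)) atTop (𝓝 0) :=
      hsmall _ 1 fun l => by rw [one_mul]; exact hhead _ m (by omega)
    have hRg : Tendsto (fun l => (M (σ l) m - ∑ i ∈ (Finset.range (m + 1)).filter (fun i => i < 4 ∧ m - i < 4),
        (m.choose i : ℝ) * polar (T (σ l) i) (T (σ l) (m - i))) / g (σ l)) atTop (𝓝 0) := by
      refine tendsto_zero_of_abs_le_mul (Ch * 2 ^ m) hw' (Filter.Eventually.of_forall fun l => ?_)
      rw [abs_div, abs_of_pos (hgσ l), div_le_iff₀ (hgσ l)]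
      exact hhd (σ l) (hσge l) m
    have := hMg.sub hRg
    rw [sub_zero] at this
    exact this.congr fun l => by ring
  have hβ00 : β (0, 0) = 0 := by
    refine tendsto_nhds_unique (hβ' (0, 0)) ?_
    have h := hheadlim 0 (by norm_num)
    exact h.congr fun l => by rw [(heads (σ l)).1]
  have hβ01 : β (0, 1) = 0 := by
    have h := hheadlim 1 (by norm_num)
    have h2 : Tendsto (fun l => G (σ l) (0, 1) / g (σ l)) atTop (𝓝 0) := by
      have := h.const_mul (1 / 2); rw [mul_zero] at this
      exact this.congr fun l => by rw [(heads (σ l)).2.1]; ring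
    exact tendsto_nhds_unique (hβ' (0, 1)) h2
  have hβ0211 : β (0, 2) + β (1, 1) = 0 := by
    have h := hheadlim 2 (by norm_num)
    have h2 : Tendsto (fun l => G (σ l) (0, 2) / g (σ l) + G (σ l) (1, 1) / g (σ l)) atTop (𝓝 0) := by
      have := h.const_mul (1 / 2); rw [mul_zero] at this
      exact this.congr fun l => by rw [(heads (σ l)).2.2.1]; ring
    exact tendsto_nhds_unique ((hβ' (0, 2)).add (hβ' (1, 1))) h2
  have hβ0312 : β (0, 3) + 3 * β (1, 2) = 0 := by
    have h := hheadlim 3 (by norm_num)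
    have h2 : Tendsto (fun l => G (σ l) (0, 3) / g (σ l) + 3 * (G (σ l) (1, 2) / g (σ l))) atTop (𝓝 0) := by
      have := h.const_mul (1 / 2); rw [mul_zero] at this
      exact this.congr fun l => by rw [(heads (σ l)).2.2.2.1]; ring
    exact tendsto_nhds_unique ((hβ' (0, 3)).add ((hβ' (1, 2)).const_mul 3)) h2
  have hβ1322 : 4 * β (1, 3) + 3 * β (2, 2) = 0 := by
    have h := hheadlim 4 (by norm_num)
    have h2 : Tendsto (fun l => 4 * (G (σ l) (1, 3) / g (σ l)) + 3 * (G (σ l) (2, 2) / g (σ l))) atTop (𝓝 0) := by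
      have := h.const_mul (1 / 2); rw [mul_zero] at this
      exact this.congr fun l => by rw [(heads (σ l)).2.2.2.2.1]; ring
    exact tendsto_nhds_unique (((hβ' (1, 3)).const_mul 4).add ((hβ' (2, 2)).const_mul 3)) h2
  have hβ23 : β (2, 3) = 0 := by
    have h := hheadlim 5 (by norm_num)
    have h2 : Tendsto (fun l => G (σ l) (2, 3) / g (σ l)) atTop (𝓝 0) := by
      have := h.const_mul (1 / 20); rw [mul_zero] at this
      exact this.congr fun l => by rw [(heads (σ l)).2.2.2.2.2.1]; ring
    exact tendsto_nhds_unique (hβ' (2, 3)) h2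
  have hβ33 : β (3, 3) = 0 := by
    have h := hheadlim 6 (by norm_num)
    have h2 : Tendsto (fun l => G (σ l) (3, 3) / g (σ l)) atTop (𝓝 0) := by
      have := h.const_mul (1 / 20); rw [mul_zero] at this
      exact this.congr fun l => by rw [(heads (σ l)).2.2.2.2.2.2.1]; ring
    exact tendsto_nhds_unique (hβ' (3, 3)) h2
  have hβsymm : ∀ i j, β (i, j) = β (j, i) := by
    intro i j
    refine tendsto_nhds_unique (hβ' (i, j)) ((hβ' (j, i)).congr fun l => ?_)
    rw [hGsymm (σ l) j i]
  -- the kernel vector survives in the limit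
  have hkerlim : ∀ j : Fin 4, ∑ i : Fin 4, kinf i * β (j, i) = 0 := by
    intro j
    have hlev : ∀ l, ∑ i : Fin 4, kv (σ l) i * (G (σ l) (j, i) / g (σ l)) = 0 := by
      intro l
      have h := hkv (σ l) (T (σ l) j)
      have : ∑ i : Fin 4, kv (σ l) i * (G (σ l) (j, i) / g (σ l)) = (∑ i : Fin 4, kv (σ l) i * polar (T (σ l) j) (T (σ l) i)) / g (σ l) := by
        rw [Finset.sum_div]; exact Finset.sum_congr rfl fun i _ => by simp only [hG]; ring
      rw [this, h, zero_div]
    have hlim := tendsto_finsetSum (Finset.univ : Finset (Fin 4)) fun i _ => (hkv' i).mul (hβ' (j, i))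
    rw [show (fun l => ∑ i : Fin 4, kv (σ l) i * (G (σ l) (j, i) / g (σ l))) = fun _ => (0 : ℝ) from funext hlev] at hlim
    exact tendsto_nhds_unique hlim tendsto_const_nhds
  -- Step 5: the common endgame — an invertible principal `3 × 3` minor kills the pure pairing
  have main : ∀ (e : Fin 3 → Fin 4), (Matrix.of fun i j : Fin 3 => β (e i, e j)).det ≠ 0 → False := by
    intro e hdet
    set Bm : ℕ → Matrix (Fin 3) (Fin 3) ℝ := fun l => Matrix.of fun i j : Fin 3 => G (σ l) (e i, e j) / g (σ l) with hBm
    set Binf : Matrix (Fin 3) (Fin 3) ℝ := Matrix.of fun i j : Fin 3 => β (e i, e j) with hBinf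
    have hBlim : Tendsto Bm atTop (𝓝 Binf) := by
      refine tendsto_pi_nhds.mpr fun i => tendsto_pi_nhds.mpr fun j => ?_
      simp only [hBm, hBinf, Matrix.of_apply]
      exact hβ' (e i, e j)
    have hdetlim : Tendsto (fun l => (Bm l).det) atTop (𝓝 Binf.det) := (continuous_id.matrix_det.tendsto Binf).comp hBlim
    obtain ⟨l₁, hl₁⟩ : ∃ l₁, ∀ l, l₁ ≤ l → |Binf.det| / 2 ≤ |(Bm l).det| := by
      have h := (continuous_abs.tendsto _).comp hdetlim
      have hev : ∀ᶠ l in atTop, |Binf.det| / 2 ≤ |(Bm l).det| :=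
        h.eventually (Ici_mem_nhds (show |Binf.det| / 2 < |Binf.det| by have := abs_pos.mpr hdet; linarith))
      exact eventually_atTop.mp hev
    -- the sub-frame
    set T3 : ℕ → Fin 3 → Matrix (Fin 2) (Fin 2) ℝ := fun l i => T (σ l) (e i) with hT3
    have hGmat : ∀ l, (Matrix.of fun i j : Fin 3 => polar (T3 l i) (T3 l j)) = g (σ l) • Bm l := by
      intro l; ext i j
      simp only [hBm, hT3, Matrix.of_apply, Matrix.smul_apply, smul_eq_mul, hG]
      rw [mul_div_cancel₀ _ (ne_of_gt (hgσ l))]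
    have hdetG : ∀ l, (Matrix.of fun i j : Fin 3 => polar (T3 l i) (T3 l j)).det = g (σ l) ^ 3 * (Bm l).det := by
      intro l; rw [hGmat, Matrix.det_smul, Fintype.card_fin]
    have hbound : ∀ l, l₁ ≤ l → |polar (Wa (σ l)) (Wb (σ l))| ≤ 36 / |Binf.det| * (N (σ l) * (N (σ l) / g (σ l))) := by
      intro l hl
      have hrig := abs_det_mul_polar_le (T3 l) (fun i => hTsymm (σ l) (e i)) (Wa (σ l)) (Wb (σ l)) (hWa _) (hWb _)
        (g (σ l)) (N (σ l)) (N (σ l)) (fun k k' => hdomG (σ l) (e k, e k'))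
        (fun i => by
          have := hmixa (σ l) (e i : ℕ) (by have := (e i).isLt; omega)
          simpa [hT3, hT] using this)
        (fun j => by
          have := hmixb (σ l) (e j : ℕ) (by have := (e j).isLt; omega)
          simpa [hT3, hT] using this)
      rw [hdetG, abs_mul, abs_pow, abs_of_pos (hgσ l)] at hrig
      have hgl := hgσ l
      have hdetB : |Binf.det| / 2 ≤ |(Bm l).det| := hl₁ l hl
      have hD0 : 0 < |Binf.det| := abs_pos.mpr hdet
      have h1 : g (σ l) ^ 3 * (|Binf.det| / 2) * |polar (Wa (σ l)) (Wb (σ l))| ≤ 18 * g (σ l) ^ 2 * N (σ l) * N (σ l) := by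
        calc g (σ l) ^ 3 * (|Binf.det| / 2) * |polar (Wa (σ l)) (Wb (σ l))|
            ≤ g (σ l) ^ 3 * |(Bm l).det| * |polar (Wa (σ l)) (Wb (σ l))| := by gcongr
          _ ≤ 18 * g (σ l) ^ 2 * N (σ l) * N (σ l) := hrig
      rw [div_mul_eq_mul_div, le_div_iff₀ hD0]
      have key : |polar (Wa (σ l)) (Wb (σ l))| * |Binf.det| * g (σ l) ≤ 36 * (N (σ l) * N (σ l)) := by
        have hg2 : 0 < g (σ l) ^ 2 := by positivity
        have h1' : g (σ l) ^ 2 * (g (σ l) * (|Binf.det| / 2) * |polar (Wa (σ l)) (Wb (σ l))|)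
            ≤ g (σ l) ^ 2 * (18 * N (σ l) * N (σ l)) := by
          convert h1 using 1 <;> ring
        have h2 := le_of_mul_le_mul_left h1' hg2
        linarith
      calc |polar (Wa (σ l)) (Wb (σ l))| * |Binf.det|
          = (|polar (Wa (σ l)) (Wb (σ l))| * |Binf.det| * g (σ l)) / g (σ l) := by field_simp
        _ ≤ 36 * (N (σ l) * N (σ l)) / g (σ l) := by gcongr
        _ = 36 * (N (σ l) * (N (σ l) / g (σ l))) := by ring
    have hzero : Tendsto (fun l => polar (Wa (σ l)) (Wb (σ l)) / N (σ l)) atTop (𝓝 0) := by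
      refine tendsto_zero_of_abs_le_mul (36 / |Binf.det|) hNg (eventually_atTop.mpr ⟨l₁, fun l hl => ?_⟩)
      rw [abs_div, abs_of_pos (hNσ l), div_le_iff₀ (hNσ l)]
      calc |polar (Wa (σ l)) (Wb (σ l))| ≤ 36 / |Binf.det| * (N (σ l) * (N (σ l) / g (σ l))) := hbound l hl
        _ = 36 / |Binf.det| * (N (σ l) / g (σ l)) * N (σ l) := by ring
    have hdσ : Tendsto (fun l => polar (Wa (σ l)) (Wb (σ l)) / N (σ l)) atTop (𝓝 d) := hpure.comp hσtop
    exact hd (tendsto_nhds_unique hdσ hzero)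
  -- Step 6: the case analysis on `X = β₀₂`, `Z = β₁₃` (with `Y = β₀₃`)
  set X : ℝ := β (0, 2) with hX
  set Y : ℝ := β (0, 3) with hY
  set Z : ℝ := β (1, 3) with hZ
  have hb11 : β (1, 1) = -X := by linarith [hβ0211]
  have hb12 : β (1, 2) = -Y / 3 := by linarith [hβ0312]
  have hb22 : β (2, 2) = -(4 / 3) * Z := by linarith [hβ1322]
  by_cases hX0 : X ≠ 0
  · refine main ![0, 1, 2] ?_
    rw [Matrix.det_fin_three]
    simp only [Matrix.of_apply, Matrix.cons_val_zero, Matrix.cons_val_one, Matrix.cons_val_two, Matrix.head_cons, Matrix.tail_cons,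
      hβ00, hβ01, hb11, hb12, ← hβsymm 0 1, ← hβsymm 0 2, ← hβsymm 1 2]
    rw [← hX]
    intro h
    have h3 : X ^ 3 = 0 := by linear_combination h
    exact hX0 ((pow_eq_zero_iff (by norm_num)).mp h3)
  · push Not at hX0
    by_cases hZ0 : Z ≠ 0
    · refine main ![1, 2, 3] ?_
      rw [Matrix.det_fin_three]
      simp only [Matrix.of_apply, Matrix.cons_val_zero, Matrix.cons_val_one, Matrix.cons_val_two, Matrix.head_cons, Matrix.tail_cons,
        hb11, hb12, hb22, hβ23, hβ33, hX0, ← hβsymm 1 2, ← hβsymm 1 3, ← hβsymm 2 3]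
      rw [← hZ]
      intro h
      have h3 : Z ^ 3 = 0 := by linear_combination (3 / 4) * h
      exact hZ0 ((pow_eq_zero_iff (by norm_num)).mp h3)
    · push Not at hZ0
      -- `X = Z = 0`: the kernel vector forces `Y = 0`, then `β = 0` — contradiction with the attained coordinate
      have hY0 : Y = 0 := by
        by_contra hY0
        have e0 := hkerlim 0
        have e1 := hkerlim 1
        have e2 := hkerlim 2
        have e3 := hkerlim 3
        simp only [Fin.sum_univ_four, hβ00, hβ01, hb11, hb12, hb22, hβ23, hβ33, ← hX, hX0, ← hY, ← hZ, hZ0] at e0 e1 e2 e3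
        rw [hβsymm 1 0, hβ01] at e1
        rw [hβsymm 2 0, ← hX, hX0, hβsymm 2 1, hb12] at e2
        rw [hβsymm 3 0, ← hY, hβsymm 3 1, ← hZ, hZ0, hβsymm 3 2, hβ23] at e3
        have k3 : kinf 3 = 0 := by
          have : kinf 3 * Y = 0 := by linarith
          exact (mul_eq_zero.mp this).resolve_right hY0
        have k2 : kinf 2 = 0 := by
          have : kinf 2 * Y = 0 := by linarith
          exact (mul_eq_zero.mp this).resolve_right hY0
        have k1 : kinf 1 = 0 := by
          have : kinf 1 * Y = 0 := by linarith
          exact (mul_eq_zero.mp this).resolve_right hY0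
        have k0 : kinf 0 = 0 := by
          have : kinf 0 * Y = 0 := by linarith
          exact (mul_eq_zero.mp this).resolve_right hY0
        have h4 : ∀ i : Fin 4, i = 0 ∨ i = 1 ∨ i = 2 ∨ i = 3 := by decide
        have : kinf i₂ = 0 := by rcases h4 i₂ with rfl | rfl | rfl | rfl <;> assumption
        rw [this, abs_zero] at hi₂; exact zero_ne_one hi₂
      have hvals : β (0, 0) = 0 ∧ β (0, 1) = 0 ∧ β (0, 2) = 0 ∧ β (0, 3) = 0 ∧ β (1, 1) = 0 ∧ β (1, 2) = 0 ∧ β (1, 3) = 0 ∧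
          β (2, 2) = 0 ∧ β (2, 3) = 0 ∧ β (3, 3) = 0 :=
        ⟨hβ00, hβ01, by rw [← hX]; exact hX0, by rw [← hY]; exact hY0, by rw [hb11, hX0, neg_zero], by rw [hb12, hY0]; ring,
          by rw [← hZ]; exact hZ0, by rw [hb22, hZ0]; ring, hβ23, hβ33⟩
      have hall : ∀ ij : Fin 4 × Fin 4, β ij = 0 := by
        rintro ⟨i, j⟩
        obtain ⟨v00, v01, v02, v03, v11, v12, v13, v22, v23, v33⟩ := hvals
        have h4 : ∀ i : Fin 4, i = 0 ∨ i = 1 ∨ i = 2 ∨ i = 3 := by decide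
        rcases h4 i with rfl | rfl | rfl | rfl <;> rcases h4 j with rfl | rfl | rfl | rfl
        all_goals first | assumption | (rw [hβsymm]; assumption)
      have := hij₁; rw [hall ij₁, abs_zero] at this; exact zero_ne_one this

end Summit.ValiantsHypothesis.ValiantsHypothesis.Theorems.LacunarySymmetroidMatrixDescartes.WallBubbling
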